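import Summits.QuantumFields.YangMills.Theorems.PoincareLipschitzLeungXinGraphStability
import Summits.QuantumFields.YangMills.Theorems.PoincareLipschitzLeungXinTwistedIdentity

/-!
# Crux `HistoryTailL` (stmt-QuantumFields-19936), K2 organ of record `hReg` = «LOC-REG-MIN» (route crux `PoincareLipschitz.BlockLipschitzL`, stmt-QuantumFields-23533):
# THE TWISTED STABILITY (LEUNG–XIN ∕ KAJIGAYA) INEQUALITY ON A FINITE GRAPH — minimality of a TWISTED discrete Dirichlet energy into `S³` along the four
# conformal curves bounds the cutoff-weighted energy by the cutoff's gradient PLUS a volume term in the squared deviation of the bond twists from `1`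

Cell `ym3-torus` (YM ladder rung R3 = continuum SU(2) Yang–Mills on the three-torus — a RUNG, NOT the Clay problem: not d = 4, not infinite
volume, not a mass gap), TWIN-WIDTH seat `ym-ust-19936-w8` gen 6 — FILE 2b of the LOC-REG-MIN stability letters (LEAD `ym-ust-19936-w1` g8 SIGNATURE
2026-08-29T04:37:09Z «w8 g6: FILE 2b against §3 — GO when both oleans exist»; the `t → 0` step is LEAD's ✓`…LeungXinGraphStability` §3, cut at abstract
per-bond data on this seat's 04:32:58Z pointer); `--supports stmt-QuantumFields-19936 --as helper`; THEOREMS ONLY, definition-free; imports LEAD's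
✓`…LeungXinGraphStability` (hence ✓FILE 1) and this seat's ✓`…LeungXinTwistedIdentity` (FILE 2), nothing else.

WHY.  ✓`graph_stability` (LEAD) is the FLAT inequality: for `u : V → S³` on a finite graph, minimality of `Σ_b |u_x − u_y|²` along the four Leung–Xin
curves gives `Σ_b η_xη_y e_b(1 + e_b∕2) ≤ 3Σ_b c_b(η_x − η_y)²`.  The energy of the relative gauge of a box-ℓ²-orbit minimiser is TWISTED,
`Σ_b |u_x − (S_b)ᵀu_y|²` with `S_b ∈ O(4)` the bond transport, and the twist transports the conformal fields: `(S_b)ᵀ·v_a(u_y) = v_{S_b a}(q_b)`,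
`q_b = (S_b)ᵀu_y` (`transpose_mulVec_tang`), and commutes with the normalised variation (`transpose_mulVec_varPt`).  So LEAD's abstract `t → 0` lemma
✓`sum_hessianForm_nonpos_of_forall_dot_le` applies verbatim at `w := (S_b)ᵀ(η_y·v_a(u_y))`, the sum over `a` is FILE 2's ✓`sum_bondHessian_twist_eq`
(`2η_xη_y·X(S_b) − 3c_b(η_x² + η_y²)`), and FILE 2's per-bond form ✓`secondVariation_twist_le` + ✓`sum_weighted_energy_le` give (`twisted_graph_stability`):

  `Σ_b η_xη_y·e_b·(1 + e_b) ≤ Σ_b [6c_b(η_x − η_y)² + η_xη_y·(4(4 − tr S_b) + 4|S_b q_b − q_b|²)] ≤ 6·Σ_b [c_b(η_x − η_y)² + η_xη_y‖S_b − 1‖_F²]`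

(`e_b = |u_x − q_b|²`, `c_b = u_x·q_b`; the Frobenius form is `twisted_graph_stability_frob`).  READING (the LOC-REG-MIN programme, LEAD ruling 04:37:48Z):
with `η` a ball cutoff and, in a ball gauge where both fields' bonds are `O(θr)`-close to `1`, `‖S_b − 1‖_F ≲ θr`:  `E(B_{r∕2}) ≲ r^{d−2} + θ²r^{d+2}` at a
box-ℓ²-orbit minimiser from MINIMALITY ALONE — normalised energy bounded by `C(1 + θ²r⁴)`, the input of the (discrete Schoen–Uhlenbeck) regularity step
behind the radius law `C(r⁻¹ + θr²)`.  NOT HERE: the `SU(2) × SU(2) → SO(4)` dictionary turning `dist1(V_b h_y W_b⁻¹ h_x⁻¹)²` into `|u_x − (S_b)ᵀu_y|²` and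
box-ℓ²-orbit minimality over `GaugeTransf` into `hmin`; hole-filling ∕ ε-regularity.

WHAT (ns `…Theorems.PoincareLipschitzLeungXinTwistedGraphStability`; FILE 1∕2 letters: `Fin 4 → ℝ`, `dotProduct`, `e_a = Pi.single a 1`, twists
`S : B → Matrix (Fin 4) (Fin 4) ℝ` with `S b * (S b)ᵀ = 1`, acting by `(S b)ᵀ *ᵥ ·` on the target end).
* §1 `transpose_mulVec_single` (`Sᵀe_a = S a`), `row_dot_transpose_mulVec` (`(S a)·(Sᵀu) = u_a`), `transpose_mulVec_dot` (`Sᵀ` is orthogonal),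
  ★`transpose_mulVec_tang` (the twist transports the conformal field), `transpose_mulVec_varPt` (and commutes with the normalised variation).
* §2 ★★★`twisted_graph_stability`, ★★`twisted_graph_stability_frob`.
* §3 ★★★`sum_energy_le_of_cutoff` — THE GROWTH BOUND: with `η ∈ [0,1]`, bond increments `≤ κ`, support bonds `⊆ D` (`#D ≤ N`), `η = 1` on the
  bonds of `A`, twists on `D` within `δ` of `1` in Frobenius norm: `Σ_{b∈A} e_b ≤ 6·N·(κ² + δ²)` (ball cutoff `κ = 1∕r`, `N ≍ r^d`, ball gauge `δ ≍ θr`: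
  `E(B_{r∕2}) ≲ r^{d−2} + θ²r^{d+2}`); the torus instantiation (cutoff on `tdist`-balls, bond count, axial ball gauge) is the consumer's.
HONEST SCOPE.  Finite-dimensional algebra over LEAD's `t → 0` lemma; nothing of `hReg`∕LOC-REG-MIN, `hG`, the charts, `BlockLipschitzL`, `HistoryTailL` or any
summit statement is proved.  YM₃ on T³ is rung R3, NOT the Clay problem.

References: Y. L. Xin, Duke Math. J. **47** (1980) 609–613 [Xin1980]; T. Kajigaya, Ann. Mat. Pura Appl. (2023), doi:10.1007∕s10231-023-01374-3, Thm 1.2 (no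
non-constant stable discrete harmonic map from a finite weighted graph into `Sⁿ`, `n ≥ 3` — the qualitative, untwisted statement); R. Schoen, K. Uhlenbeck,
J. Differential Geom. **17** (1982) 307–335; T. Bałaban, Commun. Math. Phys. **98** (1985) 17–51 [Balaban1985Averaging] (§3).
-/

set_option autoImplicit false

open scoped BigOperators
open Finset Matrix

namespace Summit.QuantumFields.YangMills.Theorems.PoincareLipschitzLeungXinTwistedGraphStability

open Summit.QuantumFields.YangMills.Theorems.PoincareLipschitzLeungXinSphereIdentity (single_dot tang_dot_self_pt varPt_dot_self)
open Summit.QuantumFields.YangMills.Theorems.PoincareLipschitzLeungXinTwistedIdentity (transpose_mul_self_of_mul_transpose_self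
  mulVec_dot_mulVec sum_bondHessian_twist_eq secondVariation_twist_le sum_weighted_energy_le dev_le_frob)
open Summit.QuantumFields.YangMills.Theorems.PoincareLipschitzLeungXinGraphStability (sum_hessianForm_nonpos_of_forall_dot_le)

/-! ## §1 The transport of the conformal fields by the bond twist -/

/-- `Sᵀ e_a = S a` (the `a`-th row of `S` is the `a`-th column of `Sᵀ`). [folklore] -/
theorem transpose_mulVec_single (S : Matrix (Fin 4) (Fin 4) ℝ) (a : Fin 4) : Sᵀ *ᵥ Pi.single a 1 = S a := by
  ext i
  rw [Matrix.mulVec, dotProduct_comm, single_dot, Matrix.transpose_apply]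

/-- `(S a)·(Sᵀ u) = u_a` for orthogonal `S` (`S Sᵀ = 1`). [folklore] -/
theorem row_dot_transpose_mulVec {S : Matrix (Fin 4) (Fin 4) ℝ} (hS : S * Sᵀ = 1) (a : Fin 4) (u : Fin 4 → ℝ) :
    dotProduct (S a) (Sᵀ *ᵥ u) = u a := by
  have h : (S *ᵥ (Sᵀ *ᵥ u)) a = u a := by rw [Matrix.mulVec_mulVec, hS, Matrix.one_mulVec]
  exact h

/-- `Sᵀ` is orthogonal too: `(Sᵀ x)·(Sᵀ y) = x·y`. [folklore] -/
theorem transpose_mulVec_dot {S : Matrix (Fin 4) (Fin 4) ℝ} (hS : S * Sᵀ = 1) (x y : Fin 4 → ℝ) :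
    dotProduct (Sᵀ *ᵥ x) (Sᵀ *ᵥ y) = dotProduct x y := by
  have hS' : Sᵀ * Sᵀᵀ = 1 := by rw [Matrix.transpose_transpose]; exact transpose_mul_self_of_mul_transpose_self hS
  exact mulVec_dot_mulVec hS' x y

/-- ★ **THE TWIST TRANSPORTS THE CONFORMAL FIELD**: `Sᵀ·v_a(u) = v_{S a}(Sᵀ u)` for orthogonal `S` — varying `u_y` along `v_a(u_y)` moves the
twisted point `q = Sᵀ u_y` along the field of the TWISTED frame vector `S a` at `q`. [folklore] -/
theorem transpose_mulVec_tang {S : Matrix (Fin 4) (Fin 4) ℝ} (hS : S * Sᵀ = 1) (a : Fin 4) (u : Fin 4 → ℝ) :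
    Sᵀ *ᵥ (Pi.single a 1 - dotProduct (Pi.single a 1) u • u) = S a - dotProduct (S a) (Sᵀ *ᵥ u) • (Sᵀ *ᵥ u) := by
  rw [Matrix.mulVec_sub, Matrix.mulVec_smul, transpose_mulVec_single, single_dot, row_dot_transpose_mulVec hS]

/-- The twist commutes with the normalised variation: `Sᵀ·γ_u^{V}(t) = γ_{Sᵀu}^{SᵀV}(t)` (orthogonal `S`; `|SᵀV| = |V|`). [folklore] -/
theorem transpose_mulVec_varPt {S : Matrix (Fin 4) (Fin 4) ℝ} (hS : S * Sᵀ = 1) (u V : Fin 4 → ℝ) (t : ℝ) :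
    Sᵀ *ᵥ ((Real.sqrt (1 + t ^ 2 * dotProduct V V))⁻¹ • (u + t • V)) =
      (Real.sqrt (1 + t ^ 2 * dotProduct (Sᵀ *ᵥ V) (Sᵀ *ᵥ V)))⁻¹ • (Sᵀ *ᵥ u + t • (Sᵀ *ᵥ V)) := by
  rw [transpose_mulVec_dot hS, Matrix.mulVec_smul, Matrix.mulVec_add, Matrix.mulVec_smul]

/-! ## §2 The twisted stability inequality on a finite graph -/

/-- ★★★ **THE TWISTED STABILITY (LEUNG–XIN ∕ KAJIGAYA) INEQUALITY ON A FINITE GRAPH, WITH A CUTOFF.**  Bonds `B` (finite; `src tgt : B → V`), a map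
`u : V → S³ ⊂ ℝ⁴` (unit vectors), per-bond TWISTS `S b` (orthogonal `4 × 4`, acting on the target end by `(S b)ᵀ`: twisted point `q_b = (S b)ᵀ u(tgt b)`),
a NON-NEGATIVE vertex weight `η`.  If for each coordinate field `a` and EVERY `t ∈ ℝ` the Leung–Xin-varied map `U_t^a` (as in ✓`graph_stability`) does not
increase the twisted correlation — `Σ_b U_t^a(src b)·(S b)ᵀU_t^a(tgt b) ≤ Σ_b u(src b)·(S b)ᵀu(tgt b)` (energy-minimality `Σ_b |p − (S b)ᵀq̃|²` along the
four curves) — then, with `e_b = |u_x − q_b|²`, `c_b = u_x·q_b`: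
`Σ_b η_xη_y·e_b·(1 + e_b) ≤ Σ_b [6c_b(η_x − η_y)² + η_xη_y·(4(4 − tr S_b) + 4|S_b q_b − q_b|²)]`
— the flat ✓`graph_stability` plus the twist's VOLUME term, nothing at first order (§3 of ✓`…GraphStability` at `w := η_y·(S b)ᵀv_a(u_y) = η_y·v_{S_b a}(q_b)`,
then ✓`sum_bondHessian_twist_eq`, ✓`secondVariation_twist_le`, ✓`sum_weighted_energy_le`). [cite: Xin1980, p.609–613; folklore] -/
theorem twisted_graph_stability {V B : Type*} [Fintype B] (src tgt : B → V) (u : V → Fin 4 → ℝ) (hu : ∀ x, dotProduct (u x) (u x) = 1)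
    (S : B → Matrix (Fin 4) (Fin 4) ℝ) (hS : ∀ b, S b * (S b)ᵀ = 1) (η : V → ℝ) (hη : ∀ x, 0 ≤ η x)
    (hmin : ∀ (a : Fin 4) (t : ℝ),
      ∑ b, dotProduct
        ((Real.sqrt (1 + t ^ 2 * dotProduct (η (src b) • (Pi.single a 1 - dotProduct (Pi.single a 1) (u (src b)) • u (src b)))
            (η (src b) • (Pi.single a 1 - dotProduct (Pi.single a 1) (u (src b)) • u (src b)))))⁻¹ •
          (u (src b) + t • (η (src b) • (Pi.single a 1 - dotProduct (Pi.single a 1) (u (src b)) • u (src b)))))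
        ((S b)ᵀ *ᵥ ((Real.sqrt (1 + t ^ 2 * dotProduct (η (tgt b) • (Pi.single a 1 - dotProduct (Pi.single a 1) (u (tgt b)) • u (tgt b)))
            (η (tgt b) • (Pi.single a 1 - dotProduct (Pi.single a 1) (u (tgt b)) • u (tgt b)))))⁻¹ •
          (u (tgt b) + t • (η (tgt b) • (Pi.single a 1 - dotProduct (Pi.single a 1) (u (tgt b)) • u (tgt b)))))) ≤
      ∑ b, dotProduct (u (src b)) ((S b)ᵀ *ᵥ u (tgt b))) :
    ∑ b, η (src b) * η (tgt b) * dotProduct (u (src b) - (S b)ᵀ *ᵥ u (tgt b)) (u (src b) - (S b)ᵀ *ᵥ u (tgt b)) *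
        (1 + dotProduct (u (src b) - (S b)ᵀ *ᵥ u (tgt b)) (u (src b) - (S b)ᵀ *ᵥ u (tgt b))) ≤
      ∑ b, (6 * dotProduct (u (src b)) ((S b)ᵀ *ᵥ u (tgt b)) * (η (src b) - η (tgt b)) ^ 2 +
        η (src b) * η (tgt b) * (4 * (4 - ∑ a : Fin 4, S b a a) +
          4 * dotProduct (S b *ᵥ ((S b)ᵀ *ᵥ u (tgt b)) - (S b)ᵀ *ᵥ u (tgt b)) (S b *ᵥ ((S b)ᵀ *ᵥ u (tgt b)) - (S b)ᵀ *ᵥ u (tgt b)))) := by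
  -- the twisted points are unit
  have hq : ∀ b, dotProduct ((S b)ᵀ *ᵥ u (tgt b)) ((S b)ᵀ *ᵥ u (tgt b)) = 1 := fun b => by
    rw [transpose_mulVec_dot (hS b), hu]
  -- Step 1: for each field `a`, the abstract `t → 0` step at `w := (S b)ᵀ (η_y • v_a(u_y))`
  have hfield : ∀ a : Fin 4,
      ∑ b, (2 * dotProduct (η (src b) • (Pi.single a 1 - dotProduct (Pi.single a 1) (u (src b)) • u (src b)))
              ((S b)ᵀ *ᵥ (η (tgt b) • (Pi.single a 1 - dotProduct (Pi.single a 1) (u (tgt b)) • u (tgt b)))) -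
            dotProduct (u (src b)) ((S b)ᵀ *ᵥ u (tgt b)) *
              (dotProduct (η (src b) • (Pi.single a 1 - dotProduct (Pi.single a 1) (u (src b)) • u (src b)))
                  (η (src b) • (Pi.single a 1 - dotProduct (Pi.single a 1) (u (src b)) • u (src b))) +
                dotProduct ((S b)ᵀ *ᵥ (η (tgt b) • (Pi.single a 1 - dotProduct (Pi.single a 1) (u (tgt b)) • u (tgt b))))
                  ((S b)ᵀ *ᵥ (η (tgt b) • (Pi.single a 1 - dotProduct (Pi.single a 1) (u (tgt b)) • u (tgt b)))))) ≤ 0 := by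
    intro a
    refine sum_hessianForm_nonpos_of_forall_dot_le Finset.univ (fun b => u (src b)) (fun b => (S b)ᵀ *ᵥ u (tgt b))
      (fun b => η (src b) • (Pi.single a 1 - dotProduct (Pi.single a 1) (u (src b)) • u (src b)))
      (fun b => (S b)ᵀ *ᵥ (η (tgt b) • (Pi.single a 1 - dotProduct (Pi.single a 1) (u (tgt b)) • u (tgt b)))) fun t => ?_
    have h := hmin a t
    simp only [transpose_mulVec_varPt (hS _)] at h
    exact h
  -- Step 2: sum over the four fields; per bond the inner sum is the TWISTED bond Hessian with `α = η_x`, `β = η_y`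
  have hsum4 := Finset.sum_nonpos fun a (_ : a ∈ (Finset.univ : Finset (Fin 4))) => hfield a
  rw [Finset.sum_comm] at hsum4
  have hper : ∀ b, ∑ a : Fin 4,
      (2 * dotProduct (η (src b) • (Pi.single a 1 - dotProduct (Pi.single a 1) (u (src b)) • u (src b)))
          ((S b)ᵀ *ᵥ (η (tgt b) • (Pi.single a 1 - dotProduct (Pi.single a 1) (u (tgt b)) • u (tgt b)))) -
        dotProduct (u (src b)) ((S b)ᵀ *ᵥ u (tgt b)) *
          (dotProduct (η (src b) • (Pi.single a 1 - dotProduct (Pi.single a 1) (u (src b)) • u (src b)))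
              (η (src b) • (Pi.single a 1 - dotProduct (Pi.single a 1) (u (src b)) • u (src b))) +
            dotProduct ((S b)ᵀ *ᵥ (η (tgt b) • (Pi.single a 1 - dotProduct (Pi.single a 1) (u (tgt b)) • u (tgt b))))
              ((S b)ᵀ *ᵥ (η (tgt b) • (Pi.single a 1 - dotProduct (Pi.single a 1) (u (tgt b)) • u (tgt b)))))) =
      2 * η (src b) * η (tgt b) *
          (∑ a : Fin 4, S b a a - dotProduct (S b *ᵥ ((S b)ᵀ *ᵥ u (tgt b))) ((S b)ᵀ *ᵥ u (tgt b)) -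
            dotProduct (u (src b)) (S b *ᵥ u (src b)) +
              dotProduct (u (src b)) ((S b)ᵀ *ᵥ u (tgt b)) * dotProduct (u (src b)) (S b *ᵥ ((S b)ᵀ *ᵥ u (tgt b)))) -
        3 * dotProduct (u (src b)) ((S b)ᵀ *ᵥ u (tgt b)) * (η (src b) ^ 2 + η (tgt b) ^ 2) := by
    intro b
    rw [← sum_bondHessian_twist_eq (hS b) (u (src b)) ((S b)ᵀ *ᵥ u (tgt b)) (hu _) (hq b) (η (src b)) (η (tgt b))]
    refine Finset.sum_congr rfl fun a _ => ?_
    rw [Matrix.mulVec_smul, transpose_mulVec_tang (hS b)]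
    simp only [smul_dotProduct, dotProduct_smul, smul_eq_mul]
    ring
  simp only [hper] at hsum4
  -- Step 3: stability form per bond, then the weighted energy bound
  have hstab : 0 ≤ ∑ b, (6 * dotProduct (u (src b)) ((S b)ᵀ *ᵥ u (tgt b)) * (η (src b) ^ 2 + η (tgt b) ^ 2) -
      4 * η (src b) * η (tgt b) *
        (∑ a : Fin 4, S b a a - dotProduct (S b *ᵥ ((S b)ᵀ *ᵥ u (tgt b))) ((S b)ᵀ *ᵥ u (tgt b)) -
          dotProduct (u (src b)) (S b *ᵥ u (src b)) +
            dotProduct (u (src b)) ((S b)ᵀ *ᵥ u (tgt b)) * dotProduct (u (src b)) (S b *ᵥ ((S b)ᵀ *ᵥ u (tgt b))))) := by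
    have : ∑ b, (6 * dotProduct (u (src b)) ((S b)ᵀ *ᵥ u (tgt b)) * (η (src b) ^ 2 + η (tgt b) ^ 2) -
        4 * η (src b) * η (tgt b) *
          (∑ a : Fin 4, S b a a - dotProduct (S b *ᵥ ((S b)ᵀ *ᵥ u (tgt b))) ((S b)ᵀ *ᵥ u (tgt b)) -
            dotProduct (u (src b)) (S b *ᵥ u (src b)) +
              dotProduct (u (src b)) ((S b)ᵀ *ᵥ u (tgt b)) * dotProduct (u (src b)) (S b *ᵥ ((S b)ᵀ *ᵥ u (tgt b))))) =
        (-2) * ∑ b, (2 * η (src b) * η (tgt b) *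
            (∑ a : Fin 4, S b a a - dotProduct (S b *ᵥ ((S b)ᵀ *ᵥ u (tgt b))) ((S b)ᵀ *ᵥ u (tgt b)) -
              dotProduct (u (src b)) (S b *ᵥ u (src b)) +
                dotProduct (u (src b)) ((S b)ᵀ *ᵥ u (tgt b)) * dotProduct (u (src b)) (S b *ᵥ ((S b)ᵀ *ᵥ u (tgt b)))) -
          3 * dotProduct (u (src b)) ((S b)ᵀ *ᵥ u (tgt b)) * (η (src b) ^ 2 + η (tgt b) ^ 2)) := by
      rw [Finset.mul_sum]
      exact Finset.sum_congr rfl fun b _ => by ring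
    rw [this]
    nlinarith [hsum4]
  exact sum_weighted_energy_le Finset.univ (fun b => dotProduct (u (src b)) ((S b)ᵀ *ᵥ u (tgt b)))
    (fun b => dotProduct (u (src b) - (S b)ᵀ *ᵥ u (tgt b)) (u (src b) - (S b)ᵀ *ᵥ u (tgt b))) (fun b => η (src b)) (fun b => η (tgt b))
    (fun b => ∑ a : Fin 4, S b a a - dotProduct (S b *ᵥ ((S b)ᵀ *ᵥ u (tgt b))) ((S b)ᵀ *ᵥ u (tgt b)) -
      dotProduct (u (src b)) (S b *ᵥ u (src b)) +
        dotProduct (u (src b)) ((S b)ᵀ *ᵥ u (tgt b)) * dotProduct (u (src b)) (S b *ᵥ ((S b)ᵀ *ᵥ u (tgt b))))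
    (fun b => 4 * (4 - ∑ a : Fin 4, S b a a) +
      4 * dotProduct (S b *ᵥ ((S b)ᵀ *ᵥ u (tgt b)) - (S b)ᵀ *ᵥ u (tgt b)) (S b *ᵥ ((S b)ᵀ *ᵥ u (tgt b)) - (S b)ᵀ *ᵥ u (tgt b)))
    (fun b _ => secondVariation_twist_le (hS b) (u (src b)) ((S b)ᵀ *ᵥ u (tgt b)) (hu _) (hq b) (hη _) (hη _)) hstab

/-- ★★ **THE SAME BOUND IN FROBENIUS LETTERS**: `Σ_b η_xη_y·e_b·(1 + e_b) ≤ 6·Σ_b [c_b(η_x − η_y)² + η_xη_y·‖S_b − 1‖_F²]` — the twist's price is a VOLUME term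
weighted by the squared deviation of the bond twist from the identity (✓`dev_le_frob`).  With `η` a ball cutoff and `‖S_b − 1‖_F ≲ θr` in a ball gauge:
`E(B_{r∕2}) ≲ r^{d−2} + θ²r^{d+2}` from minimality alone. [cite: Xin1980, p.609–613; folklore] -/
theorem twisted_graph_stability_frob {V B : Type*} [Fintype B] (src tgt : B → V) (u : V → Fin 4 → ℝ) (hu : ∀ x, dotProduct (u x) (u x) = 1)
    (S : B → Matrix (Fin 4) (Fin 4) ℝ) (hS : ∀ b, S b * (S b)ᵀ = 1) (η : V → ℝ) (hη : ∀ x, 0 ≤ η x)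
    (hmin : ∀ (a : Fin 4) (t : ℝ),
      ∑ b, dotProduct
        ((Real.sqrt (1 + t ^ 2 * dotProduct (η (src b) • (Pi.single a 1 - dotProduct (Pi.single a 1) (u (src b)) • u (src b)))
            (η (src b) • (Pi.single a 1 - dotProduct (Pi.single a 1) (u (src b)) • u (src b)))))⁻¹ •
          (u (src b) + t • (η (src b) • (Pi.single a 1 - dotProduct (Pi.single a 1) (u (src b)) • u (src b)))))
        ((S b)ᵀ *ᵥ ((Real.sqrt (1 + t ^ 2 * dotProduct (η (tgt b) • (Pi.single a 1 - dotProduct (Pi.single a 1) (u (tgt b)) • u (tgt b)))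
            (η (tgt b) • (Pi.single a 1 - dotProduct (Pi.single a 1) (u (tgt b)) • u (tgt b)))))⁻¹ •
          (u (tgt b) + t • (η (tgt b) • (Pi.single a 1 - dotProduct (Pi.single a 1) (u (tgt b)) • u (tgt b)))))) ≤
      ∑ b, dotProduct (u (src b)) ((S b)ᵀ *ᵥ u (tgt b))) :
    ∑ b, η (src b) * η (tgt b) * dotProduct (u (src b) - (S b)ᵀ *ᵥ u (tgt b)) (u (src b) - (S b)ᵀ *ᵥ u (tgt b)) *
        (1 + dotProduct (u (src b) - (S b)ᵀ *ᵥ u (tgt b)) (u (src b) - (S b)ᵀ *ᵥ u (tgt b))) ≤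
      6 * ∑ b, (dotProduct (u (src b)) ((S b)ᵀ *ᵥ u (tgt b)) * (η (src b) - η (tgt b)) ^ 2 +
        η (src b) * η (tgt b) * ∑ a : Fin 4, ∑ i : Fin 4, (S b a i - (1 : Matrix (Fin 4) (Fin 4) ℝ) a i) ^ 2) := by
  have hq : ∀ b, dotProduct ((S b)ᵀ *ᵥ u (tgt b)) ((S b)ᵀ *ᵥ u (tgt b)) = 1 := fun b => by
    rw [transpose_mulVec_dot (hS b), hu]
  refine (twisted_graph_stability src tgt u hu S hS η hη hmin).trans ?_
  rw [Finset.mul_sum]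
  refine Finset.sum_le_sum fun b _ => ?_
  have hdev := dev_le_frob (hS b) ((S b)ᵀ *ᵥ u (tgt b)) (hq b)
  have hηη : 0 ≤ η (src b) * η (tgt b) := mul_nonneg (hη _) (hη _)
  nlinarith [mul_le_mul_of_nonneg_left hdev hηη]

/-! ## §3 The growth bound: a cutoff turns stability into `E(inner ball) ≤ 6·#(support bonds)·(κ² + δ²)` -/

/-- ★★★ **THE STABILITY GROWTH BOUND WITH A CUTOFF.**  In the setting of `twisted_graph_stability` let the weight `η` take values in `[0, 1]`, have bond
increments `|η_x − η_y| ≤ κ`, vanish at both ends of every bond outside a finite set `D` of at most `N` bonds, equal `1` at both ends of every bond of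
`A`, and let the twists on `D` deviate from `1` by at most `δ` in Frobenius norm.  Then the twisted energy of `A` obeys
`Σ_{b ∈ A} |u_x − q_b|² ≤ 6·N·(κ² + δ²)` — from MINIMALITY ALONE: with `η` the linear cutoff of a ball of radius `r` (`κ = 1∕r`), `N ≍ r^d` and a ball
gauge (`δ ≍ θr`) this is `E(B_{r∕2}) ≲ r^{d−2} + θ²r^{d+2}`, normalised energy `≲ 1 + θ²r⁴`. [cite: Xin1980, p.609–613; folklore] -/
theorem sum_energy_le_of_cutoff {V B : Type*} [Fintype B] [DecidableEq B] (src tgt : B → V) (u : V → Fin 4 → ℝ)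
    (hu : ∀ x, dotProduct (u x) (u x) = 1) (S : B → Matrix (Fin 4) (Fin 4) ℝ) (hS : ∀ b, S b * (S b)ᵀ = 1) (η : V → ℝ) (hη : ∀ x, 0 ≤ η x)
    (hη1 : ∀ x, η x ≤ 1)
    (hmin : ∀ (a : Fin 4) (t : ℝ),
      ∑ b, dotProduct
        ((Real.sqrt (1 + t ^ 2 * dotProduct (η (src b) • (Pi.single a 1 - dotProduct (Pi.single a 1) (u (src b)) • u (src b)))
            (η (src b) • (Pi.single a 1 - dotProduct (Pi.single a 1) (u (src b)) • u (src b)))))⁻¹ •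
          (u (src b) + t • (η (src b) • (Pi.single a 1 - dotProduct (Pi.single a 1) (u (src b)) • u (src b)))))
        ((S b)ᵀ *ᵥ ((Real.sqrt (1 + t ^ 2 * dotProduct (η (tgt b) • (Pi.single a 1 - dotProduct (Pi.single a 1) (u (tgt b)) • u (tgt b)))
            (η (tgt b) • (Pi.single a 1 - dotProduct (Pi.single a 1) (u (tgt b)) • u (tgt b)))))⁻¹ •
          (u (tgt b) + t • (η (tgt b) • (Pi.single a 1 - dotProduct (Pi.single a 1) (u (tgt b)) • u (tgt b)))))) ≤
      ∑ b, dotProduct (u (src b)) ((S b)ᵀ *ᵥ u (tgt b)))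
    (D : Finset B) {N : ℕ} (hDN : D.card ≤ N) (hD : ∀ b, b ∉ D → η (src b) = 0 ∧ η (tgt b) = 0)
    {κ : ℝ} (hκ : ∀ b, |η (src b) - η (tgt b)| ≤ κ)
    {δ : ℝ} (hδ : ∀ b ∈ D, ∑ a : Fin 4, ∑ i : Fin 4, (S b a i - (1 : Matrix (Fin 4) (Fin 4) ℝ) a i) ^ 2 ≤ δ ^ 2)
    (A : Finset B) (hA : ∀ b ∈ A, η (src b) = 1 ∧ η (tgt b) = 1) :
    ∑ b ∈ A, dotProduct (u (src b) - (S b)ᵀ *ᵥ u (tgt b)) (u (src b) - (S b)ᵀ *ᵥ u (tgt b)) ≤ 6 * N * (κ ^ 2 + δ ^ 2) := by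
  have hstab := twisted_graph_stability_frob src tgt u hu S hS η hη hmin
  have hq : ∀ b, dotProduct ((S b)ᵀ *ᵥ u (tgt b)) ((S b)ᵀ *ᵥ u (tgt b)) = 1 := fun b => by
    rw [transpose_mulVec_dot (hS b), hu]
  have he0 : ∀ b, 0 ≤ dotProduct (u (src b) - (S b)ᵀ *ᵥ u (tgt b)) (u (src b) - (S b)ᵀ *ᵥ u (tgt b)) := fun b => by
    show 0 ≤ ∑ i, _ * _
    exact Finset.sum_nonneg fun i _ => mul_self_nonneg _
  have hfrob0 : ∀ b, 0 ≤ ∑ a : Fin 4, ∑ i : Fin 4, (S b a i - (1 : Matrix (Fin 4) (Fin 4) ℝ) a i) ^ 2 := fun b =>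
    Finset.sum_nonneg fun a _ => Finset.sum_nonneg fun i _ => sq_nonneg _
  -- (1) the energy of `A` sits below the weighted left side
  have hAsub : ∑ b ∈ A, dotProduct (u (src b) - (S b)ᵀ *ᵥ u (tgt b)) (u (src b) - (S b)ᵀ *ᵥ u (tgt b)) ≤
      ∑ b, η (src b) * η (tgt b) * dotProduct (u (src b) - (S b)ᵀ *ᵥ u (tgt b)) (u (src b) - (S b)ᵀ *ᵥ u (tgt b)) *
        (1 + dotProduct (u (src b) - (S b)ᵀ *ᵥ u (tgt b)) (u (src b) - (S b)ᵀ *ᵥ u (tgt b))) := by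
    calc ∑ b ∈ A, dotProduct (u (src b) - (S b)ᵀ *ᵥ u (tgt b)) (u (src b) - (S b)ᵀ *ᵥ u (tgt b))
        ≤ ∑ b ∈ A, η (src b) * η (tgt b) * dotProduct (u (src b) - (S b)ᵀ *ᵥ u (tgt b)) (u (src b) - (S b)ᵀ *ᵥ u (tgt b)) *
            (1 + dotProduct (u (src b) - (S b)ᵀ *ᵥ u (tgt b)) (u (src b) - (S b)ᵀ *ᵥ u (tgt b))) := by
          refine Finset.sum_le_sum fun b hb => ?_
          obtain ⟨h1, h2⟩ := hA b hb
          rw [h1, h2, one_mul, one_mul]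
          have := he0 b
          nlinarith
      _ ≤ _ := by
          refine Finset.sum_le_univ_sum_of_nonneg fun b => ?_
          have := he0 b
          have := mul_nonneg (hη (src b)) (hη (tgt b))
          positivity
  -- (2) the right side: only bonds of `D` contribute, each at most `κ² + δ²`
  have hterm : ∀ b, dotProduct (u (src b)) ((S b)ᵀ *ᵥ u (tgt b)) * (η (src b) - η (tgt b)) ^ 2 +
      η (src b) * η (tgt b) * ∑ a : Fin 4, ∑ i : Fin 4, (S b a i - (1 : Matrix (Fin 4) (Fin 4) ℝ) a i) ^ 2 ≤
      if b ∈ D then κ ^ 2 + δ ^ 2 else 0 := by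
    intro b
    by_cases hb : b ∈ D
    · rw [if_pos hb]
      -- `c_b ≤ 1` (Cauchy–Schwarz for unit vectors; ★w7 g11's ✓`…BoxCaccioppoli.dot_le_one` is the same letter — inlined to keep the import graph acyclic)
      have hc : dotProduct (u (src b)) ((S b)ᵀ *ᵥ u (tgt b)) ≤ 1 := by
        have h := Finset.sum_mul_sq_le_sq_mul_sq (Finset.univ : Finset (Fin 4)) (u (src b)) ((S b)ᵀ *ᵥ u (tgt b))
        have hp' : ∑ i : Fin 4, u (src b) i ^ 2 = 1 := by rw [← hu (src b)]; exact Finset.sum_congr rfl fun i _ => sq _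
        have hq' : ∑ i : Fin 4, ((S b)ᵀ *ᵥ u (tgt b)) i ^ 2 = 1 := by rw [← hq b]; exact Finset.sum_congr rfl fun i _ => sq _
        rw [hp', hq', mul_one] at h
        have : |dotProduct (u (src b)) ((S b)ᵀ *ᵥ u (tgt b))| ≤ 1 := by rw [← sq_le_one_iff_abs_le_one]; exact h
        exact (abs_le.mp this).2
      have h1 : (η (src b) - η (tgt b)) ^ 2 ≤ κ ^ 2 := by
        have := hκ b
        rw [← sq_abs]
        exact pow_le_pow_left₀ (abs_nonneg _) this 2
      have h2 : η (src b) * η (tgt b) ≤ 1 := by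
        calc η (src b) * η (tgt b) ≤ 1 * 1 := mul_le_mul (hη1 _) (hη1 _) (hη _) zero_le_one
          _ = 1 := one_mul 1
      have h3 := hδ b hb
      have hsq0 : 0 ≤ (η (src b) - η (tgt b)) ^ 2 := sq_nonneg _
      nlinarith [hfrob0 b, mul_nonneg (hη (src b)) (hη (tgt b))]
    · rw [if_neg hb]
      obtain ⟨h1, h2⟩ := hD b hb
      rw [h1, h2]
      simp
  have hRHS : 6 * ∑ b, (dotProduct (u (src b)) ((S b)ᵀ *ᵥ u (tgt b)) * (η (src b) - η (tgt b)) ^ 2 +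
      η (src b) * η (tgt b) * ∑ a : Fin 4, ∑ i : Fin 4, (S b a i - (1 : Matrix (Fin 4) (Fin 4) ℝ) a i) ^ 2) ≤ 6 * N * (κ ^ 2 + δ ^ 2) := by
    have h1 : ∑ b, (dotProduct (u (src b)) ((S b)ᵀ *ᵥ u (tgt b)) * (η (src b) - η (tgt b)) ^ 2 +
        η (src b) * η (tgt b) * ∑ a : Fin 4, ∑ i : Fin 4, (S b a i - (1 : Matrix (Fin 4) (Fin 4) ℝ) a i) ^ 2) ≤
        ∑ b, (if b ∈ D then κ ^ 2 + δ ^ 2 else 0) := Finset.sum_le_sum fun b _ => hterm b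
    have h2 : ∑ b, (if b ∈ D then κ ^ 2 + δ ^ 2 else (0 : ℝ)) = D.card * (κ ^ 2 + δ ^ 2) := by
      rw [Finset.sum_ite_mem, Finset.univ_inter, Finset.sum_const, nsmul_eq_mul]
    rw [h2] at h1
    have hN : (D.card : ℝ) ≤ N := by exact_mod_cast hDN
    have hkd : 0 ≤ κ ^ 2 + δ ^ 2 := by positivity
    nlinarith [mul_le_mul_of_nonneg_right hN hkd]
  linarith [hAsub, hstab, hRHS]

end Summit.QuantumFields.YangMills.Theorems.PoincareLipschitzLeungXinTwistedGraphStability
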